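import Literature.AlgebraicGeometry.Modules.SerreTwistModCharts
import Literature.AlgebraicGeometry.Modules.SerreTwistSum
import Literature.AlgebraicGeometry.Modules.IdealMul
import Literature.AlgebraicGeometry.Modules.LocalExactness
import Literature.AlgebraicGeometry.Modules.StalkExactCoherent
import Literature.AlgebraicGeometry.KTheory.PullbackVectorBundle
import Literature.AlgebraicGeometry.Modules.PushforwardUnitHom
import HarnessLib

/-!
# The Serre twist `N ↦ N(e)` is an exact functor, and it commutes with `𝒥·(–)` and `(–)/𝒥(–)`

Layer `Literature/AlgebraicGeometry/Modules` (0 definitions, 0 named facts, no instances, no notation). For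
`ι : Z ⟶ 𝐏ʳ_A`, a sheaf of `𝒪_Z`-modules `N` and `e : ℕ`, the positive twist `N(e) = SerreTwist.twistMod ι N e` of
`Modules/SerreTwistMod` (sections over `U` = chart families `(n_j ∈ Γ(U ∩ Z_j, N))_j` with the transition rule of
`𝒪(e)`; functorial in `N` by `twistModMap`, `twistModFunctor` of `Modules/SerreTwistModCharts`). Since on each chart
`Z_j` the twist is the identity functor (`chartEquiv`), twisting is EXACT and commutes with every construction that is
local on `Z` — here with the submodule `𝒥N ⊆ N` and the quotient `N/𝒥N` of an ideal sheaf `𝒥` (`Modules/IdealMul`):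

* §1 `twistModMap_app_injective`, **`mono_twistModMap`**, **`epi_twistModMap`** (local surjectivity through the
  chart coordinates), **`exact_map_twistModFunctor`** (an exact `M' → M → M''` with `M' → M` mono stays exact: the
  componentwise lifts of a section form a twist family), **`shortExact_map_twistModFunctor`** — `N ↦ N(e)` is exact
  (Hartshorne II Prop. 5.12 (b)/(c): `𝒪(n)` is invertible, so `– ⊗ 𝒪(n)` is exact; here in the Čech model);
* §2 `chartEquiv_res_eq_map_comp` (the chart coordinate of a restricted section is the restricted chart piece),
  `isIdealMulSection_comp_of_isIdealMulSection`, `isIdealMulSection_of_forall_comp` and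
  **`isIdealMulSection_twistMod_iff_forall_comp`**: a section of `N(e)` is a `𝒥`-PRODUCT SECTION iff all its chart
  pieces are;
* §3 `twistModMap_idealMulι_comp_idealQuotπ`, `idealMulι_comp_twistModMap_idealQuotπ`, **`exists_iso_twistMod_idealMul`**: `(𝒥N)(e) ≅ 𝒥(N(e))` compatibly with the inclusions into `N(e)` (both
  inclusions are kernels — `Modules/IdealMul.shortExact_idealMul` and its twist by §1 — and each factors through the
  other by §2), and **`exists_iso_twistMod_idealQuot`**: `(N/𝒥N)(e) ≅ N(e)/𝒥N(e)` compatibly with the projections.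

Written for the cell `hodgecm-mathlib` (D-0151), F-DAG F-5 §3 (β′) «large-`m` base change of `(p_Z)_*𝒪_Z(m)` along a
closed immersion of the base» (Mumford, *Curves on an algebraic surface*, Lect. 7 3° (i)), whose Serre-vanishing steps
run on `𝒥·𝒪_Z(m) ≅ (𝒥𝒪_Z)(m)`; count-neutral capital; HC_CM is proved only modulo the 7 printed citations until rung 0
closes; nothing here is about HC.

## References

* R. Hartshorne, *Algebraic Geometry*, GTM 52 (1977), II Prop. 5.12 (p. 117) (twists on `Proj`), II Ex. 1.8 (p. 66)
  (sections are left exact), II Prop. 5.9 (p. 116) and p. 115 (`𝒥𝓕`, `𝓕/𝒥𝓕`). [Hartshorne1977]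
* The Stacks Project, Tag 01CL (Modules, closed immersions and ideal sheaves of modules). [StacksProject]
* D. Mumford, *Lectures on Curves on an Algebraic Surface*, Annals of Math. Studies 59 (1966), Lecture 7, 3° (i)
  (p. 40). [Mumford1966CurvesSurface]
-/

noncomputable section

-- `TopCat.Presheaf`/`Scheme.Modules` are not reducible (as in Mathlib's `AlgebraicGeometry/Modules`).
set_option backward.isDefEq.respectTransparency false

universe u

open CategoryTheory CategoryTheory.Limits AlgebraicGeometry TopologicalSpace Opposite
open Literature.Algebra.Homology Literature.Algebra.Homology.LaurentCech
open Literature.AlgebraicGeometry.Morphisms Literature.AlgebraicGeometry.Morphisms.ProjCech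
open Literature.AlgebraicGeometry.KTheory (app_injective_of_mono)

namespace Literature.AlgebraicGeometry.Modules

namespace SerreTwist

variable {A : Type u} [CommRing A] {r : ℕ} {Z : Scheme.{u}} (ι : Z ⟶ PP A r) {N N' : Z.Modules}

/-! ## §1 Exactness of `N ↦ N(e)` -/

/-- `φ(e)` is injective on the sections over `U` as soon as `φ` is injective on the sections over the chart pieces
`U ∩ Z_j` (the chart pieces of `φ(e) n` are `φ(n_j)`). [cite: Hartshorne1977, II Prop. 5.12] -/
theorem twistModMap_app_injective (φ : N ⟶ N') (e : ℕ) (U : Z.Opens)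
    (hφ : ∀ j, Function.Injective (φ.app (U ⊓ Zop ι {j}))) :
    Function.Injective ((twistModMap ι φ e).app U) := fun n n' h =>
  twistMod_ext ι N fun j => hφ j (by rw [← comp_twistModMap_app, ← comp_twistModMap_app, h])

/-- **Twisting preserves monomorphisms.** [cite: Hartshorne1977, II Prop. 5.12] -/
theorem mono_twistModMap (φ : N ⟶ N') [Mono φ] (e : ℕ) : Mono (twistModMap ι φ e) :=
  mono_of_app_injective _ fun U => twistModMap_app_injective ι φ e U fun _ => app_injective_of_mono φ _

/-- The chart coordinate of a restricted section is the restricted chart piece: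
`chartEquiv (n|_W) = n_j|_W` for `W ⊆ U ∩ Z_j` (the trivialisation of `𝒪(e)` on the chart `Z_j`).
[cite: Hartshorne1977, II Prop. 5.12] -/
theorem chartEquiv_res_eq_map_comp (e : ℕ) {j : Fin (r + 1)} {U W : Z.Opens} (hWU : W ≤ U) (hWj : W ≤ Zop ι {j})
    (n : Γ(twistMod ι N e, U)) :
    chartEquiv ι N e hWj ((twistMod ι N e).presheaf.map (homOfLE hWU).op n) =
      N.presheaf.map (homOfLE (le_inf hWU hWj : W ≤ U ⊓ Zop ι {j})).op (comp ι N n j) := by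
  rw [chartEquiv_apply, comp_map, moduleMap_map_apply]

/-- **Twisting preserves epimorphisms**: `φ(e)` is locally surjective, because on a chart piece `W ⊆ Z_{j₀}` a local
preimage under `φ` of the chart coordinate of a section of `N'(e)` is the chart coordinate of a preimage under `φ(e)`.
[cite: Hartshorne1977, II Prop. 5.12] -/
theorem epi_twistModMap (φ : N ⟶ N') [Epi φ] (e : ℕ) : Epi (twistModMap ι φ e) := by
  -- `φ` is locally surjective
  have hloc : TopCat.Presheaf.IsLocallySurjective φ.mapPresheaf :=
    (TopCat.Presheaf.locally_surjective_iff_surjective_on_stalks φ.mapPresheaf).mpr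
      fun x => stalkFunctor_map_surjective_of_epi x φ
  rw [TopCat.Presheaf.isLocallySurjective_iff] at hloc
  refine epi_of_locallySurjective _ fun U t x hx => ?_
  -- a chart containing `x`
  obtain ⟨j₀, hj₀⟩ := Opens.mem_iSup.mp (le_iSup_inf_Zop ι U hx)
  set V : Z.Opens := U ⊓ Zop ι {j₀}
  have hVU : V ≤ U := inf_le_left
  have hVj : V ≤ Zop ι {j₀} := inf_le_right
  -- the chart coordinate of `t|_V`, and a local preimage of it under `φ`
  obtain ⟨W, hWV, ⟨s, hs⟩, hxW⟩ := hloc V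
    (chartEquiv ι N' e hVj ((twistMod ι N' e).presheaf.map (homOfLE hVU).op t)) x hj₀
  refine ⟨W, hWV.trans hVU, hxW, (chartEquiv ι N e (hWV.trans hVj)).symm s, ?_⟩
  apply (chartEquiv ι N' e (hWV.trans hVj)).injective
  rw [chartEquiv_twistModMap, LinearEquiv.apply_symm_apply]
  change φ.mapPresheaf.app (op W) s = _ at hs
  change φ.mapPresheaf.app (op W) s = _
  rw [hs]
  change N'.presheaf.map (homOfLE hWV).op (chartEquiv ι N' e hVj _) = _
  rw [← chartEquiv_map ι N' e hVj hWV, moduleMap_map_apply]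

/-- **Twisting is exact**: for an exact `M' —f→ M —g→ M''` with `f` a monomorphism, `M'(e) → M(e) → M''(e)` is exact —
a section `n` of `M(e)` killed by `g(e)` has chart pieces `n_j = f(a_j)` for unique `a_j` (sections are left exact,
`Modules/SectionsExact`), and `(a_j)_j` satisfies the transition rule because `(f(a_j))_j` does and `f` is injective on
sections. [cite: Hartshorne1977, II Prop. 5.12 and II Ex. 1.8 (p. 66)] -/
theorem exact_map_twistModFunctor {S : ShortComplex Z.Modules} (hS : S.Exact) [Mono S.f] (e : ℕ) :
    (S.map (twistModFunctor ι e)).Exact := by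
  refine exact_of_locally_exact _ fun V n hn x hx => ⟨V, 𝟙 V, hx, ?_⟩
  -- componentwise lifts
  have hcomp : ∀ j, S.g.app _ (comp ι S.X₂ n j) = 0 := fun j => by
    have h := congrArg (fun m => comp ι S.X₃ m j) hn
    change comp ι S.X₃ ((twistModMap ι S.g e).app V n) j = comp ι S.X₃ (0 : Γ(twistMod ι S.X₃ e, V)) j at h
    rwa [comp_twistModMap_app, comp_zero] at h
  choose a ha using fun j => (sections_exact_of_exact_of_mono hS (V ⊓ Zop ι {j})).2 _ (hcomp j)
  have hinj : ∀ W : Z.Opens, Function.Injective (S.f.app W) := fun W => app_injective_of_mono S.f W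
  -- the lifts form a twist family
  have htw : IsTwistFamily ι S.X₁ e V a := by
    intro j j' W hW hj hj'
    apply hinj
    rw [Scheme.Modules.Hom.app_smul, ← hom_map_app, ← hom_map_app, ha, ha]
    exact isTwistFamily_comp ι S.X₂ n j j' hW hj hj'
  refine ⟨mkFamily ι S.X₁ a htw, ?_⟩
  have hid : (S.map (twistModFunctor ι e)).X₂.presheaf.map (𝟙 V).op n = n := by
    rw [op_id, CategoryTheory.Functor.map_id]; rfl
  rw [hid]
  exact twistMod_ext ι S.X₂ fun j => by
    rw [ShortComplex.map_f]
    change comp ι S.X₂ ((twistModMap ι S.f e).app V (mkFamily ι S.X₁ a htw)) j = _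
    rw [comp_twistModMap_app, comp_mkFamily, ha]

/-- **Twisting preserves short exact sequences.** [cite: Hartshorne1977, II Prop. 5.12] -/
theorem shortExact_map_twistModFunctor {S : ShortComplex Z.Modules} (hS : S.ShortExact) (e : ℕ) :
    (S.map (twistModFunctor ι e)).ShortExact := by
  haveI := hS.mono_f
  haveI := hS.epi_g
  haveI : Mono (S.map (twistModFunctor ι e)).f := mono_twistModMap ι S.f e
  haveI : Epi (S.map (twistModFunctor ι e)).g := epi_twistModMap ι S.g e
  exact ShortComplex.ShortExact.mk' (exact_map_twistModFunctor ι hS.exact e) inferInstance inferInstance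

/-! ## §2 `𝒥`-product sections of `N(e)` are the sections whose chart pieces are `𝒥`-product sections -/

variable (N)

omit ι in
/-- A linear equivalence of section modules over `Γ(V, 𝒪_Z)` (e.g. a chart coordinate) carries `𝒥(V)·Γ(V, M)` into
`𝒥(V)·Γ(V, M')`. [folklore] -/
private theorem mem_ideal_smul_top_of_linearMap {V : Z.affineOpens} (J : Z.IdealSheafData) {P Q : Type*}
    [AddCommGroup P] [Module Γ(Z, (V : Z.Opens)) P] [AddCommGroup Q] [Module Γ(Z, (V : Z.Opens)) Q]
    (f : P →ₗ[Γ(Z, (V : Z.Opens))] Q) {m : P} (hm : m ∈ J.ideal V • (⊤ : Submodule Γ(Z, (V : Z.Opens)) P)) :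
    f m ∈ J.ideal V • (⊤ : Submodule Γ(Z, (V : Z.Opens)) Q) := by
  have h : m ∈ (J.ideal V • (⊤ : Submodule _ Q)).comap f := by
    refine Submodule.smul_induction_on hm (fun a ha p _ => ?_) (fun p q hp hq => ?_)
    · simp only [Submodule.mem_comap, map_smul]
      exact Submodule.smul_mem_smul ha trivial
    · simp only [Submodule.mem_comap, map_add] at hp hq ⊢
      exact Submodule.add_mem _ hp hq
  exact h

/-- **A `𝒥`-product section of `N(e)` has `𝒥`-product chart pieces.** [cite: StacksProject, Tag 01CL] -/
theorem isIdealMulSection_comp_of_isIdealMulSection (J : Z.IdealSheafData) (e : ℕ) {U : Z.Opens}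
    {n : Γ(twistMod ι N e, U)} (hn : IsIdealMulSection (twistMod ι N e) J U n) (j : Fin (r + 1)) :
    IsIdealMulSection N J (U ⊓ Zop ι {j}) (comp ι N n j) := by
  intro x hx
  obtain ⟨W, hWU, hxW, hmem⟩ := hn x hx.1
  -- shrink to an affine inside the chart
  obtain ⟨W', hW', hxW', hW'le⟩ := Opens.isBasis_iff_nbhd.mp Z.isBasis_affineOpens
    (show x ∈ (W : Z.Opens) ⊓ Zop ι {j} from ⟨hxW, hx.2⟩)
  have hW'W : W' ≤ (W : Z.Opens) := hW'le.trans inf_le_left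
  have hW'j : W' ≤ Zop ι {j} := hW'le.trans inf_le_right
  refine ⟨⟨W', hW'⟩, le_inf (hW'W.trans hWU) hW'j, hxW', ?_⟩
  -- `n|_{W'} ∈ 𝒥(W')·Γ(W', N(e))`, and its chart coordinate is `n_j|_{W'}`
  have hmem' := map_mem_ideal_smul_top (V := W) (V' := ⟨W', hW'⟩) hW'W hmem
  rw [map_map] at hmem'
  have key := mem_ideal_smul_top_of_linearMap (V := ⟨W', hW'⟩) J
    (chartEquiv ι N e hW'j).toLinearMap hmem'
  rw [LinearEquiv.coe_toLinearMap] at key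
  have e1 : (homOfLE hWU).op ≫ (homOfLE hW'W).op = (homOfLE (hW'W.trans hWU) : W' ⟶ U).op := Subsingleton.elim _ _
  rw [e1, chartEquiv_res_eq_map_comp ι e (hW'W.trans hWU) hW'j n] at key
  convert key using 2

/-- **A section of `N(e)` all of whose chart pieces are `𝒥`-product sections is a `𝒥`-product section** (on an affine
`W ⊆ U ∩ Z_j` around a point, `n|_W` is the inverse chart coordinate of `n_j|_W`). [cite: StacksProject, Tag 01CL] -/
theorem isIdealMulSection_of_forall_comp (J : Z.IdealSheafData) (e : ℕ) {U : Z.Opens} (n : Γ(twistMod ι N e, U))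
    (hn : ∀ j, IsIdealMulSection N J (U ⊓ Zop ι {j}) (comp ι N n j)) : IsIdealMulSection (twistMod ι N e) J U n := by
  intro x hx
  obtain ⟨j, hj⟩ := Opens.mem_iSup.mp (le_iSup_inf_Zop ι U hx)
  obtain ⟨W, hWU, hxW, hmem⟩ := hn j x hj
  have hWU' : (W : Z.Opens) ≤ U := hWU.trans inf_le_left
  have hWj : (W : Z.Opens) ≤ Zop ι {j} := hWU.trans inf_le_right
  refine ⟨W, hWU', hxW, ?_⟩
  -- `n|_W = chartEquiv⁻¹ (n_j|_W)`
  have key := mem_ideal_smul_top_of_linearMap (V := W) J (chartEquiv ι N e hWj).symm.toLinearMap hmem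
  rw [LinearEquiv.coe_toLinearMap] at key
  have e1 : N.presheaf.map (homOfLE hWU).op (comp ι N n j) =
      chartEquiv ι N e hWj ((twistMod ι N e).presheaf.map (homOfLE hWU').op n) := by
    rw [chartEquiv_res_eq_map_comp ι e hWU' hWj n]
  rwa [e1, LinearEquiv.symm_apply_apply] at key

/-- **A section of `N(e)` is a `𝒥`-product section iff all its chart pieces are.** [cite: StacksProject, Tag 01CL] -/
theorem isIdealMulSection_twistMod_iff_forall_comp (J : Z.IdealSheafData) (e : ℕ) {U : Z.Opens}
    (n : Γ(twistMod ι N e, U)) :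
    IsIdealMulSection (twistMod ι N e) J U n ↔ ∀ j, IsIdealMulSection N J (U ⊓ Zop ι {j}) (comp ι N n j) :=
  ⟨fun hn j => isIdealMulSection_comp_of_isIdealMulSection ι N J e hn j, isIdealMulSection_of_forall_comp ι N J e n⟩

/-! ## §3 `(𝒥N)(e) ≅ 𝒥(N(e))` and `(N/𝒥N)(e) ≅ N(e)/𝒥N(e)` -/

/-- `(𝒥N)(e) → N(e) → N(e)/𝒥N(e)` is zero: sections of `(𝒥N)(e)` are `𝒥`-product sections of `N(e)` (their chart pieces
are sections of `𝒥N`). [cite: StacksProject, Tag 01CL] -/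
theorem twistModMap_idealMulι_comp_idealQuotπ (J : Z.IdealSheafData) (e : ℕ) :
    twistModMap ι (idealMulι N J) e ≫ idealQuotπ (twistMod ι N e) J = 0 := by
  refine Scheme.Modules.hom_ext _ _ fun U => ?_
  ext a : 2
  change (idealQuotπ (twistMod ι N e) J).app U ((twistModMap ι (idealMulι N J) e).app U a) = 0
  have hprod : IsIdealMulSection (twistMod ι N e) J U ((twistModMap ι (idealMulι N J) e).app U a) :=
    isIdealMulSection_of_forall_comp ι N J e _ fun j => by
      rw [comp_twistModMap_app]
      exact isIdealMulSection_idealMulι_app N J _ _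
  obtain ⟨b, hb⟩ := exists_idealMulι_app_eq _ J _ hprod
  rw [← hb]
  exact app_app_eq_zero (ShortComplex.mk (idealMulι _ J) (idealQuotπ _ J) (cokernel.condition _)) U b

/-- `𝒥(N(e)) → N(e) → (N/𝒥N)(e)` is zero: the chart pieces of a `𝒥`-product section of `N(e)` are sections of `𝒥N`,
killed by `N → N/𝒥N`. [cite: StacksProject, Tag 01CL] -/
theorem idealMulι_comp_twistModMap_idealQuotπ (J : Z.IdealSheafData) (e : ℕ) :
    idealMulι (twistMod ι N e) J ≫ twistModMap ι (idealQuotπ N J) e = 0 := by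
  refine Scheme.Modules.hom_ext _ _ fun U => ?_
  ext m : 2
  change (twistModMap ι (idealQuotπ N J) e).app U ((idealMulι (twistMod ι N e) J).app U m) = 0
  refine twistMod_ext ι _ fun j => ?_
  rw [comp_twistModMap_app, comp_zero]
  have hprod := isIdealMulSection_comp_of_isIdealMulSection ι N J e (isIdealMulSection_idealMulι_app _ J U m) j
  obtain ⟨b, hb⟩ := exists_idealMulι_app_eq _ J _ hprod
  rw [← hb]
  exact app_app_eq_zero (ShortComplex.mk (idealMulι N J) (idealQuotπ N J) (cokernel.condition _)) _ b

/-- **`(𝒥N)(e) ≅ 𝒥(N(e))`, compatibly with the inclusions into `N(e)`**: both inclusions are kernels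
(`0 → 𝒥M → M → M/𝒥M → 0` for `M = N(e)`, and the twist of the one for `M = N`, short exact by §1), and each is killed by
the other's cokernel. [cite: Hartshorne1977, II Prop. 5.12] [cite: StacksProject, Tag 01CL] -/
theorem exists_iso_twistMod_idealMul (J : Z.IdealSheafData) (e : ℕ) :
    ∃ φ : twistMod ι (idealMul N J) e ≅ idealMul (twistMod ι N e) J,
      φ.hom ≫ idealMulι (twistMod ι N e) J = twistModMap ι (idealMulι N J) e := by
  -- the two short exact sequences
  have hS := shortExact_idealMul (twistMod ι N e) J
  have hT := shortExact_map_twistModFunctor ι (shortExact_idealMul N J) e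
  -- mutual factorisations
  let l₁ := KernelFork.IsLimit.lift' hS.fIsKernel (twistModMap ι (idealMulι N J) e)
    (twistModMap_idealMulι_comp_idealQuotπ ι N J e)
  let l₂ := KernelFork.IsLimit.lift' hT.fIsKernel (idealMulι (twistMod ι N e) J)
    (idealMulι_comp_twistModMap_idealQuotπ ι N J e)
  have h₁ : l₁.1 ≫ idealMulι (twistMod ι N e) J = twistModMap ι (idealMulι N J) e := l₁.2
  have h₂ : l₂.1 ≫ twistModMap ι (idealMulι N J) e = idealMulι (twistMod ι N e) J := l₂.2
  haveI : Mono (twistModMap ι (idealMulι N J) e) := mono_twistModMap ι _ e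
  refine ⟨⟨l₁.1, l₂.1, ?_, ?_⟩, h₁⟩
  · rw [← cancel_mono (twistModMap ι (idealMulι N J) e), Category.assoc, h₂, h₁, Category.id_comp]
  · rw [← cancel_mono (idealMulι (twistMod ι N e) J), Category.assoc, h₁, h₂, Category.id_comp]

/-- **`(N/𝒥N)(e) ≅ N(e)/𝒥N(e)`, compatibly with the projections from `N(e)`**: both projections are cokernels of the
(isomorphic) inclusions `(𝒥N)(e) ≅ 𝒥(N(e)) ↪ N(e)`. [cite: Hartshorne1977, II Prop. 5.12] [cite: StacksProject, Tag 01CL] -/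
theorem exists_iso_twistMod_idealQuot (J : Z.IdealSheafData) (e : ℕ) :
    ∃ ψ : twistMod ι (idealQuot N J) e ≅ idealQuot (twistMod ι N e) J,
      twistModMap ι (idealQuotπ N J) e ≫ ψ.hom = idealQuotπ (twistMod ι N e) J := by
  obtain ⟨φ, hφ⟩ := exists_iso_twistMod_idealMul ι N J e
  have hS := shortExact_idealMul (twistMod ι N e) J
  have hT := shortExact_map_twistModFunctor ι (shortExact_idealMul N J) e
  -- `N(e) → N(e)/𝒥N(e)` kills `(𝒥N)(e)` and `N(e) → (N/𝒥N)(e)` kills `𝒥(N(e))`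
  have w₁ : twistModMap ι (idealMulι N J) e ≫ idealQuotπ (twistMod ι N e) J = 0 :=
    twistModMap_idealMulι_comp_idealQuotπ ι N J e
  have w₂ : idealMulι (twistMod ι N e) J ≫ twistModMap ι (idealQuotπ N J) e = 0 :=
    idealMulι_comp_twistModMap_idealQuotπ ι N J e
  let d₁ := CokernelCofork.IsColimit.desc' hT.gIsCokernel (idealQuotπ (twistMod ι N e) J) w₁
  let d₂ := CokernelCofork.IsColimit.desc' hS.gIsCokernel (twistModMap ι (idealQuotπ N J) e) w₂
  have h₁ : twistModMap ι (idealQuotπ N J) e ≫ d₁.1 = idealQuotπ (twistMod ι N e) J := d₁.2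
  have h₂ : idealQuotπ (twistMod ι N e) J ≫ d₂.1 = twistModMap ι (idealQuotπ N J) e := d₂.2
  haveI : Epi (twistModMap ι (idealQuotπ N J) e) := epi_twistModMap ι _ e
  refine ⟨⟨d₁.1, d₂.1, ?_, ?_⟩, h₁⟩
  · rw [← cancel_epi (twistModMap ι (idealQuotπ N J) e), reassoc_of% h₁, h₂, Category.comp_id]
  · rw [← cancel_epi (idealQuotπ (twistMod ι N e) J), reassoc_of% h₂, h₁, Category.comp_id]

end SerreTwist

end Literature.AlgebraicGeometry.Modules

end
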